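import Summits.Langlands.Langlands.Theorems.ParityBlindBianchiIcosahedralDescentLevelEquiv
import Literature.NumberTheory.Automorphic.OddArtinWeightOne
import Literature.NumberTheory.GaloisRepresentations.EvenGaloisRep

/-!
# The crux `IcosahedralDescentLevel` (stmt-Langlands-15113) AS TYPED is the route's OWN rank-0 target,
# modulo two theorems in print (Khare–Wintenberger 2009, Booker 2003)

Status file of the line `Sketch` (lead prover, continuation seat c4; `--supports stmt-Langlands-15113`).

Seat c3 landed (`…IcosahedralDescentLevelEquiv`, p116764) the unconditional by-name equivalence
`iff_strongArtinIcosahedralQ : IcosahedralDescentLevel ↔ GaloisWeightedBE.StrongArtinIcosahedralQ`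
(strong Artin, a.e., for EVERY irreducible icosahedral `ρ : Γ_ℚ → GL₂(ℂ)`), i.e. the rank-5 crux of
`ParityBlindBianchi` as typed is the sibling route's open target, a STRENGTHENING of this route's own
target `EvenIcosahedralStrongArtin` (stmt-Langlands-2903: the same for EVEN `ρ` only).

This file removes the word "strengthening".  Over `ℚ` every two-dimensional `ρ` is odd or even
(`isOdd_or_isEven`: all complex conjugations of `Γ_ℚ` are conjugate, tree
`IsComplexConjugation.isConj`, and `det ρ(c) = ±1`, tree `det_sq_eq_one_of_isComplexConjugation`), and
the ODD icosahedral case of strong Artin is a theorem in print, vendored in the tree as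
`strongArtin_ae_of_isOdd` from the two named facts
`khareWintenberger_artinConjecture_of_isOdd` (Khare–Wintenberger 2009, §10: Artin's conjecture for odd
irreducible `ρ : Γ_ℚ → GL₂(ℂ)`) and `booker_strongArtin_of_artinConjecture` (Booker 2003, Corollary:
Artin ⇒ strong Artin for two-dimensional `ρ/ℚ`).  Hence, GRANTED THOSE TWO PRINTED THEOREMS ONLY:

* `strongArtinIcosahedralQ_iff_evenIcosahedralStrongArtin` — the two sibling rank-0 targets
  `GaloisWeightedBE.StrongArtinIcosahedralQ` (stmt-Langlands-10841) and
  `ParityBlindBianchi.EvenIcosahedralStrongArtin` (stmt-Langlands-2903) are EQUIVALENT;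
* `iff_evenIcosahedralStrongArtin` — **`IcosahedralDescentLevel ↔ EvenIcosahedralStrongArtin`**: crux #5
  of route `ParityBlindBianchi` AS TYPED *is* the route's own rank-0 target.  The deciding theorem
  `closes (hE1) (hE2) (hR) (hD) (hJ)` therefore consumes, in `hD`, a hypothesis equivalent (modulo
  print) to the target it derives — the route as typed is CIRCULAR, not merely too strong;
* `icosahedralDescentLevel_of_evenIcosahedralStrongArtin` — the backward direction spelled out.

Nothing here bears on the REPAIRED statement D″ (`∃ S₀, (0 : ℕ) ∉ S₀ ∧ …`, the planner's intended
crux), which is landed modulo the four Arthur–Clozel facts (`icosahedralDescentLevel_repaired`,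
p111861) and is NOT equivalent to any target: the circularity is entirely the junk bad set `S₀ = {0}`
(`Negative.no_good_place_of_zero_mem`, p90502).  Restatement package: item evidence `sig_DR_c3.txt` /
`sig_DCond_c3.txt` / `sig_E1R_c3.txt`, `RestateCheck.lean` (c3), `Restatement.lean` (c1).
-/

-- `Summit.Langlands.Langlands.…`: the repeated path component is the tree's layout (D-0017).
set_option linter.dupNamespace false

noncomputable section

open scoped MatrixGroups NumberField
open NumberField IsDedekindDomain Field Filter
open Literature.NumberTheory.Automorphic Literature.NumberTheory.GaloisRepresentations
open Summit.Langlands.Langlands.Theses.ParityBlindBianchi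
open Summit.Langlands.Langlands.Theses.GaloisWeightedBE (StrongArtinIcosahedralQ)

namespace Summit.Langlands.Langlands.Theorems.IcosahedralDescentLevel

/-- **Parity dichotomy over `ℚ`.**  A framed Galois representation `ρ : Γ_ℚ → GL_n(ℂ)` is odd
(`det ρ(c) = -1` at every complex conjugation `c`) or even (`det ρ(c) = 1` at every complex
conjugation, the tree's `FramedGaloisRep.IsEven`): `ℚ` has one real embedding (`Subsingleton (ℚ →+* ℝ)`), any two complex conjugations
for it are conjugate in `Γ_ℚ` (tree `IsComplexConjugation.isConj`), so `det ρ(c)` does not depend on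
`c`, and `det ρ(c)² = 1` (tree `det_sq_eq_one_of_isComplexConjugation`) in the domain `ℂ`.
Serre, Duke Math. J. 54 (1987), §1.1. [folklore] -/
theorem isOdd_or_isEven {n : ℕ} (ρ : FramedGaloisRep ℚ ℂ n) : ρ.IsOdd ∨ ρ.IsEven := by
  -- one complex conjugation `c₀` for the unique real embedding
  obtain ⟨c₀, hc₀⟩ := exists_isComplexConjugation (Rat.castHom ℝ)
  -- `det ρ(c)` is the same at every complex conjugation
  have hconst : ∀ (φ : ℚ →+* ℝ) (c : absoluteGaloisGroup ℚ), IsComplexConjugation φ c →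
      Matrix.GeneralLinearGroup.det (ρ c) = Matrix.GeneralLinearGroup.det (ρ c₀) := by
    intro φ c hc
    obtain rfl : φ = Rat.castHom ℝ := Subsingleton.elim _ _
    obtain ⟨g, hg⟩ := isConj_iff.mp (hc₀.isConj hc)
    rw [← hg, map_mul, map_mul, map_mul, map_mul, map_inv, map_inv, mul_comm, ← mul_assoc,
      inv_mul_cancel, one_mul]
  -- `det ρ(c₀) = ±1`
  have hsq : (Matrix.GeneralLinearGroup.det (ρ c₀) : ℂ) ^ 2 = 1 := by
    rw [← Units.val_pow_eq_pow_val, ρ.det_sq_eq_one_of_isComplexConjugation hc₀, Units.val_one]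
  rcases sq_eq_one_iff.mp hsq with h1 | h1
  · refine Or.inr fun φ c hc => ?_
    rw [hconst φ c hc]
    exact Units.ext (by rw [h1, Units.val_one])
  · refine Or.inl fun φ c hc => ?_
    rw [hconst φ c hc]
    exact Units.ext (by rw [h1, Units.val_neg, Units.val_one])

/-- **Odd ∪ even = all: the sibling targets agree modulo print.**  Granted Artin's conjecture for
odd two-dimensional `ρ/ℚ` (`khareWintenberger_artinConjecture_of_isOdd`, Khare–Wintenberger 2009,
§10) and Booker's criterion (`booker_strongArtin_of_artinConjecture`, Booker 2003, Corollary), strong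
Artin (a.e.) for every EVEN irreducible icosahedral `ρ : Γ_ℚ → GL₂(ℂ)`
(`ParityBlindBianchi.EvenIcosahedralStrongArtin`, stmt-Langlands-2903) already gives it for EVERY
irreducible icosahedral `ρ` (`GaloisWeightedBE.StrongArtinIcosahedralQ`, stmt-Langlands-10841): the
odd ones are the tree's `strongArtin_ae_of_isOdd`, and every `ρ` is odd or even
(`isOdd_or_isEven`; `FramedGaloisRep.IsEven` is the target's parity clause verbatim). [folklore] -/
theorem strongArtinIcosahedralQ_of_evenIcosahedralStrongArtin
    (hKW : khareWintenberger_artinConjecture_of_isOdd)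
    (hB : booker_strongArtin_of_artinConjecture) (hE : EvenIcosahedralStrongArtin) :
    StrongArtinIcosahedralQ := by
  intro σ hirr hA5
  rcases isOdd_or_isEven σ with hodd | heven
  · exact strongArtin_ae_of_isOdd hKW hB σ hirr hodd
  · exact hE σ hirr ((isIcosahedralType_iff σ).mp hA5) heven

/-- **The two sibling rank-0 targets are equivalent modulo print**: granted
`khareWintenberger_artinConjecture_of_isOdd` and `booker_strongArtin_of_artinConjecture`,
`GaloisWeightedBE.StrongArtinIcosahedralQ` (stmt-Langlands-10841, all parities) `↔`
`ParityBlindBianchi.EvenIcosahedralStrongArtin` (stmt-Langlands-2903, even only); the forward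
direction is unconditional (forget the parity hypothesis). [folklore] -/
theorem strongArtinIcosahedralQ_iff_evenIcosahedralStrongArtin
    (hKW : khareWintenberger_artinConjecture_of_isOdd)
    (hB : booker_strongArtin_of_artinConjecture) :
    StrongArtinIcosahedralQ ↔ EvenIcosahedralStrongArtin :=
  ⟨fun h ρ hirr hA5 _ => h ρ hirr ((isIcosahedralType_iff ρ).mpr hA5),
    strongArtinIcosahedralQ_of_evenIcosahedralStrongArtin hKW hB⟩

/-- **The typed crux is the route's own target (modulo print): `closes` is circular as typed.**
Granted the two printed theorems `khareWintenberger_artinConjecture_of_isOdd` (Khare–Wintenberger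
2009) and `booker_strongArtin_of_artinConjecture` (Booker 2003),
`ParityBlindBianchi.IcosahedralDescentLevel` (stmt-Langlands-15113, crux #5, billed "theorem-sized
uniform descent") is EQUIVALENT to `ParityBlindBianchi.EvenIcosahedralStrongArtin`
(stmt-Langlands-2903), the rank-0 target that the deciding theorem `closes` derives from it: c3's
unconditional `iff_strongArtinIcosahedralQ` composed with
`strongArtinIcosahedralQ_iff_evenIcosahedralStrongArtin`.  The defect is the junk bad set
`S₀ = {0}` admitted by `∃ S₀ : Finset ℕ` (no place is good, the compatibility clause is vacuous);
the repaired statement `∃ S₀, (0 : ℕ) ∉ S₀ ∧ …` is landed modulo the four Arthur–Clozel facts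
(`icosahedralDescentLevel_repaired`) and is equivalent to no target. [folklore] -/
theorem iff_evenIcosahedralStrongArtin (hKW : khareWintenberger_artinConjecture_of_isOdd)
    (hB : booker_strongArtin_of_artinConjecture) :
    IcosahedralDescentLevel ↔ EvenIcosahedralStrongArtin :=
  iff_strongArtinIcosahedralQ.trans (strongArtinIcosahedralQ_iff_evenIcosahedralStrongArtin hKW hB)

/-- **Backward direction spelled out**: modulo Khare–Wintenberger and Booker, this route's rank-0
target ALONE proves its rank-5 crux as typed — so no line, stub or base-change fact can close
stmt-Langlands-15113 short of closing stmt-Langlands-2903 / stmt-Langlands-10841 themselves.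
[folklore] -/
theorem icosahedralDescentLevel_of_evenIcosahedralStrongArtin
    (hKW : khareWintenberger_artinConjecture_of_isOdd)
    (hB : booker_strongArtin_of_artinConjecture) (hE : EvenIcosahedralStrongArtin) :
    IcosahedralDescentLevel :=
  (iff_evenIcosahedralStrongArtin hKW hB).mpr hE

end Summit.Langlands.Langlands.Theorems.IcosahedralDescentLevel

end
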